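import Summits.AtomisticToContinuum.Crystallization.Theorems.HullExactificationCascadeZeroDefectDensityBctLattice
import HarnessLib

/-!
# A two-shell radially tight site that is not `1/20`-good — part 2: the witness theorem
# (route `HullExactificationCascade`, crux `ZeroDefectDensity`, stmt-AtomisticToContinuum-12086;
# line `registered`/`birth`)

Part 1 (`…BctLattice.lean`) sets up the body-centred-tetragonal witness
`S = {(25a, 25b, 27c) : a + b + c even}`: nearest-neighbour distance `√1250` at every site, the
strict `13/10·d`-shell of every site is the twelve-point set `P(u + w)`, `w ∈ fccInt`, all within
`21/20·d` (radial tightness everywhere).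

This file: distinct points of the fcc / hcp kissing patterns are at squared distance `≤ 2` or
`≥ 8/3` (integer arithmetic on the tree's integer models `fccInt`, `hcpInt`); the shell of a site contains `P(u + (1,0,1))`, `P(u + (1,0,-1))` at rescaled distance
`54/√1250 ∈ (1.52, 1.53)`; under a `1/20`-matching through a linear isometry the image pair would be
two DISTINCT pattern points at distance within `1/10` of it, i.e. in `(1.42, 1.63)`, but pattern
distances are `≤ √2 < 1.4143` or `≥ √(8/3) > 1.6329` — so no site of `S` is `SiteGood`
(`bct_not_siteGood`).  The witness theorems `exists_allSites_twoShellTight_not_siteGood` and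
`not_forall_twoShellTight_imp_siteGood` state, in the registered stubs' verbatim (let-free)
vocabulary with `Set.range (x N)` ↦ `S`, that POINTWISE "radially tight two shells deep ⇒
`SiteGood`" is false at the route's constants (`13/10`, `21/20`, `1/20`): the line's third stub
`stub_orientationalOrder` is an energetic statement about ground states, not geometry.
No definitions and no notation are introduced.
-/

noncomputable section

namespace Summit.AtomisticToContinuum.Crystallization.Theorems.ZeroDefectDensityBirth

open Literature.Geometry.DiscreteGeometry

/-! ## Pair distances of the two patterns -/

/-- Squared distances between distinct fcc minimal vectors are `2, 4, 6` or `8`; in particular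
`≤ 4` or `≥ 6`. [folklore] -/
theorem fccInt_pair_sq : ∀ v ∈ fccInt, ∀ w ∈ fccInt, v ≠ w →
    sqNormInt (v - w) ≤ 4 ∨ 6 ≤ sqNormInt (v - w) := by
  decide

/-- Squared distances between distinct vectors of the integer hcp model are
`18, 36, 48, 54, 66` or `72`; in particular `≤ 36` or `≥ 48`. [folklore] -/
theorem hcpInt_pair_sq : ∀ v ∈ hcpInt, ∀ w ∈ hcpInt, v ≠ w →
    sqNormInt (v - w) ≤ 36 ∨ 48 ≤ sqNormInt (v - w) := by
  decide

/-- Squared distance in a scaled pattern: `dist(v/√N, w/√N)² = |v - w|² / N`. [folklore] -/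
theorem dist_sq_of_mem_scaledPattern {S : Finset (Fin 3 → ℤ)} {N : ℕ} (hN : N ≠ 0)
    {x y : EuclideanSpace ℝ (Fin 3)} (hx : x ∈ scaledPattern S N) (hy : y ∈ scaledPattern S N) :
    ∃ v ∈ S, ∃ w ∈ S, x = (Real.sqrt N)⁻¹ • intVec v ∧ y = (Real.sqrt N)⁻¹ • intVec w ∧
      dist x y ^ 2 = (sqNormInt (v - w) : ℝ) / N := by
  obtain ⟨v, hv, rfl⟩ := Finset.mem_image.1 hx
  obtain ⟨w, hw, rfl⟩ := Finset.mem_image.1 hy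
  refine ⟨v, hv, w, hw, rfl, rfl, ?_⟩
  have hpos : (0 : ℝ) < Real.sqrt N := by positivity
  have hsq : (0 : ℝ) ≤ (sqNormInt (v - w) : ℝ) := by
    have : (0 : ℤ) ≤ sqNormInt (v - w) := by unfold sqNormInt; positivity
    exact_mod_cast this
  rw [dist_eq_norm, ← smul_sub, intVec_sub, norm_smul, norm_inv, Real.norm_of_nonneg hpos.le,
    norm_intVec, mul_pow, inv_pow, Real.sq_sqrt hsq, Real.sq_sqrt (by positivity)]
  rw [div_eq_inv_mul]

/-- Pair-distance dichotomy for the cuboctahedron: distinct points are at squared distance `≤ 2`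
or `≥ 8/3` (in fact `∈ {1, 2, 3, 4}`). [folklore] -/
theorem fcc_pair_dichotomy : ∀ q₁ ∈ fccKissingPattern, ∀ q₂ ∈ fccKissingPattern, q₁ ≠ q₂ →
    dist q₁ q₂ ^ 2 ≤ 2 ∨ 8 / 3 ≤ dist q₁ q₂ ^ 2 := by
  intro q₁ h₁ q₂ h₂ hne
  obtain ⟨v, hv, w, hw, rfl, rfl, hd⟩ := dist_sq_of_mem_scaledPattern two_ne_zero h₁ h₂
  have hvw : v ≠ w := fun h => hne (by rw [h])
  rw [hd]
  rcases fccInt_pair_sq v hv w hw hvw with h | h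
  · left
    have h' : (sqNormInt (v - w) : ℝ) ≤ 4 := by exact_mod_cast h
    push_cast
    linarith
  · right
    have h' : (6 : ℝ) ≤ (sqNormInt (v - w) : ℝ) := by exact_mod_cast h
    push_cast
    linarith

/-- Pair-distance dichotomy for the anticuboctahedron: distinct points are at squared distance
`≤ 2` or `≥ 8/3` (in fact `∈ {1, 2, 8/3, 3, 11/3, 4}`). [folklore] -/
theorem hcp_pair_dichotomy : ∀ q₁ ∈ hcpKissingPattern, ∀ q₂ ∈ hcpKissingPattern, q₁ ≠ q₂ →
    dist q₁ q₂ ^ 2 ≤ 2 ∨ 8 / 3 ≤ dist q₁ q₂ ^ 2 := by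
  intro q₁ h₁ q₂ h₂ hne
  obtain ⟨v, hv, w, hw, rfl, rfl, hd⟩ :=
    dist_sq_of_mem_scaledPattern (by norm_num : (18 : ℕ) ≠ 0) h₁ h₂
  have hvw : v ≠ w := fun h => hne (by rw [h])
  rw [hd]
  rcases hcpInt_pair_sq v hv w hw hvw with h | h
  · left
    have h' : (sqNormInt (v - w) : ℝ) ≤ 36 := by exact_mod_cast h
    push_cast
    rw [div_le_iff₀ (by norm_num)]
    linarith
  · right
    have h' : (48 : ℝ) ≤ (sqNormInt (v - w) : ℝ) := by exact_mod_cast h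
    push_cast
    rw [le_div_iff₀ (by norm_num)]
    linarith

/-! ## No `1/20`-matching of the shell to either pattern -/

/-- Numeric core: no `r ≥ 0` with `r² ≤ 2` or `r² ≥ 8/3` lies within `1/10` of `54/√1250`
(`≈ 1.5274`; `√2 ≈ 1.4142`, `√(8/3) ≈ 1.6330`). [folklore] -/
theorem no_pattern_distance_near (r : ℝ) (hr : 0 ≤ r) (h : r ^ 2 ≤ 2 ∨ 8 / 3 ≤ r ^ 2)
    (h₁ : (Real.sqrt 1250)⁻¹ * 54 ≤ r + 1 / 10) (h₂ : r ≤ (Real.sqrt 1250)⁻¹ * 54 + 1 / 10) :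
    False := by
  have hs1 : Real.sqrt 1250 < 35.36 := by
    rw [Real.sqrt_lt' (by norm_num)]
    norm_num
  have hs2 : (35.35 : ℝ) < Real.sqrt 1250 := by
    rw [Real.lt_sqrt (by norm_num)]
    norm_num
  have hpos : 0 < Real.sqrt 1250 := by positivity
  have hc1 : (1.52 : ℝ) < (Real.sqrt 1250)⁻¹ * 54 := by
    rw [inv_mul_eq_div, lt_div_iff₀ hpos]
    nlinarith
  have hc2 : (Real.sqrt 1250)⁻¹ * 54 < 1.53 := by
    rw [inv_mul_eq_div, div_lt_iff₀ hpos]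
    nlinarith
  rcases h with h | h
  · nlinarith [sq_nonneg (r - 1.42), sq_nonneg (r + 1.42)]
  · nlinarith [sq_nonneg (r - 1.63), sq_nonneg (r + 1.63)]

/-- **No matching.** For a site `P u` of the witness set, no bijection of its shell with a finite
set `Q` whose distinct points are at squared distance `≤ 2` or `≥ 8/3` can be `1/20`-close after a
linear isometry `A` (at scale `D = √1250`): the shell pair `P(u + (1,0,1))`, `P(u + (1,0,-1))` has
rescaled distance `54/√1250`, and a `1/20`-matching moves pair distances by at most `1/10`.
[folklore] -/
theorem bct_noMatch {P : (Fin 3 → ℤ) → EuclideanSpace ℝ (Fin 3)}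
    (hP : ∀ w, P w = intVec ![25 * w 0, 25 * w 1, 27 * w 2]) (u : Fin 3 → ℤ)
    (A : EuclideanSpace ℝ (Fin 3) →ₗᵢ[ℝ] EuclideanSpace ℝ (Fin 3))
    (Q : Finset (EuclideanSpace ℝ (Fin 3)))
    (hQ : ∀ q₁ ∈ Q, ∀ q₂ ∈ Q, q₁ ≠ q₂ → dist q₁ q₂ ^ 2 ≤ 2 ∨ 8 / 3 ≤ dist q₁ q₂ ^ 2)
    {D : ℝ} (hD : D = Real.sqrt 1250) {T : Set (EuclideanSpace ℝ (Fin 3))}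
    (hT : T = ((fccInt.image fun w : Fin 3 → ℤ => P (u + w) : Finset (EuclideanSpace ℝ (Fin 3))) :
      Set (EuclideanSpace ℝ (Fin 3))))
    (e : ↥T ≃ ↥Q)
    (he : ∀ t : ↥T, dist (D⁻¹ • ((t : EuclideanSpace ℝ (Fin 3)) - P u))
      (A ((e t : ↥Q) : EuclideanSpace ℝ (Fin 3))) ≤ 1 / 20) :
    False := by
  subst hD hT
  have hm : ∀ w ∈ fccInt, P (u + w) ∈
      ((fccInt.image fun w : Fin 3 → ℤ => P (u + w) : Finset (EuclideanSpace ℝ (Fin 3))) :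
        Set (EuclideanSpace ℝ (Fin 3))) :=
    fun w hw => Finset.mem_coe.2 (Finset.mem_image_of_mem _ hw)
  set t₁ : ↥((fccInt.image fun w : Fin 3 → ℤ => P (u + w) : Finset (EuclideanSpace ℝ (Fin 3))) :
      Set (EuclideanSpace ℝ (Fin 3))) := ⟨P (u + ![1, 0, 1]), hm _ (by decide)⟩ with ht₁
  set t₂ : ↥((fccInt.image fun w : Fin 3 → ℤ => P (u + w) : Finset (EuclideanSpace ℝ (Fin 3))) :
      Set (EuclideanSpace ℝ (Fin 3))) := ⟨P (u + ![1, 0, -1]), hm _ (by decide)⟩ with ht₂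
  have hne : t₁ ≠ t₂ := by
    intro h
    have h' : P (u + ![1, 0, 1]) = P (u + ![1, 0, -1]) := congrArg Subtype.val h
    have h'' := congrFun (bct_label_eq hP h') 2
    simp only [Pi.add_apply, Matrix.cons_val] at h''
    omega
  have hq : ((e t₁ : ↥Q) : EuclideanSpace ℝ (Fin 3)) ≠ ((e t₂ : ↥Q) : EuclideanSpace ℝ (Fin 3)) :=
    fun h => hne (e.injective (Subtype.ext h))
  have h1 := he t₁
  have h2 := he t₂
  have hpos : (0 : ℝ) < Real.sqrt 1250 := by positivity
  have h12 : dist ((Real.sqrt 1250)⁻¹ • ((t₁ : EuclideanSpace ℝ (Fin 3)) - P u))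
      ((Real.sqrt 1250)⁻¹ • ((t₂ : EuclideanSpace ℝ (Fin 3)) - P u)) =
        (Real.sqrt 1250)⁻¹ * 54 := by
    rw [dist_smul₀, dist_sub_right, norm_inv, Real.norm_of_nonneg hpos.le]
    congr 1
    show dist (P (u + ![1, 0, 1])) (P (u + ![1, 0, -1])) = 54
    rw [bct_dist hP _ _ (![0, 0, 2]) (by ext i; fin_cases i <;> simp)]
    simp only [Matrix.cons_val_zero, Matrix.cons_val_one, Matrix.cons_val]
    rw [show (((625 * 0 ^ 2 + 625 * 0 ^ 2 + 729 * 2 ^ 2 : ℤ) : ℤ) : ℝ) = 54 ^ 2 by norm_num,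
      Real.sqrt_sq (by norm_num)]
  have hA12 : dist (A ((e t₁ : ↥Q) : EuclideanSpace ℝ (Fin 3)))
      (A ((e t₂ : ↥Q) : EuclideanSpace ℝ (Fin 3))) =
        dist ((e t₁ : ↥Q) : EuclideanSpace ℝ (Fin 3)) ((e t₂ : ↥Q) : EuclideanSpace ℝ (Fin 3)) :=
    A.dist_map _ _
  have tri1 := dist_triangle4 ((Real.sqrt 1250)⁻¹ • ((t₁ : EuclideanSpace ℝ (Fin 3)) - P u))
    (A ((e t₁ : ↥Q) : EuclideanSpace ℝ (Fin 3))) (A ((e t₂ : ↥Q) : EuclideanSpace ℝ (Fin 3)))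
    ((Real.sqrt 1250)⁻¹ • ((t₂ : EuclideanSpace ℝ (Fin 3)) - P u))
  have tri2 := dist_triangle4 (A ((e t₁ : ↥Q) : EuclideanSpace ℝ (Fin 3)))
    ((Real.sqrt 1250)⁻¹ • ((t₁ : EuclideanSpace ℝ (Fin 3)) - P u))
    ((Real.sqrt 1250)⁻¹ • ((t₂ : EuclideanSpace ℝ (Fin 3)) - P u))
    (A ((e t₂ : ↥Q) : EuclideanSpace ℝ (Fin 3)))
  rw [h12, hA12, dist_comm (A _) _] at tri1
  rw [hA12, h12, dist_comm (A _) _] at tri2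
  exact no_pattern_distance_near _ dist_nonneg (hQ _ (e t₁).2 _ (e t₂).2 hq) (by linarith)
    (by linarith)

/-- **No site of the witness set is `SiteGood`.** [folklore] -/
theorem bct_not_siteGood {P : (Fin 3 → ℤ) → EuclideanSpace ℝ (Fin 3)}
    (hP : ∀ w, P w = intVec ![25 * w 0, 25 * w 1, 27 * w 2]) {S : Set (EuclideanSpace ℝ (Fin 3))}
    (hS : S = {p | ∃ w : Fin 3 → ℤ, (w 0 + w 1 + w 2) % 2 = 0 ∧ P w = p})
    (u : Fin 3 → ℤ) (hu : (u 0 + u 1 + u 2) % 2 = 0) : ¬ SiteGood S (P u) := by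
  intro h
  simp only [SiteGood] at h
  obtain ⟨A, ⟨e, he⟩ | ⟨e, he⟩⟩ := h
  · exact bct_noMatch hP u A fccKissingPattern fcc_pair_dichotomy (bct_sInf hP hS u hu)
      (by rw [bct_sInf hP hS u hu]; exact bct_shell_eq hP hS u hu) e he
  · exact bct_noMatch hP u A hcpKissingPattern hcp_pair_dichotomy (bct_sInf hP hS u hu)
      (by rw [bct_sInf hP hS u hu]; exact bct_shell_eq hP hS u hu) e he

/-! ## The witness, in the line's vocabulary -/

/-- **Pointwise two-shell radial tightness does not imply goodness.** There is a nonempty,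
uniformly discrete point set `S ⊆ ℝ³` (the `27/25` bct stretch of the fcc lattice) ALL of whose
points are radially tight in the sense of the crux line — the strict `13/10·d`-shell (`d` the distance
to the rest of `S`) has exactly twelve points, all within `21/20·d` — hence radially tight two shells
deep (indeed at every depth), and yet NO point of `S` is `SiteGood` (its rescaled shell is not
`1/20`-matched to a linearly isometric copy of the fcc or of the hcp kissing pattern).  The
two-shell predicate is written verbatim as registered in the stubs `stub_twoShellSpread` /
`stub_orientationalOrder` of the birth skeleton, with `Set.range (x N)` replaced by `S` and `x N i`
by `y`. [folklore] -/
theorem exists_allSites_twoShellTight_not_siteGood :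
    ∃ S : Set (EuclideanSpace ℝ (Fin 3)), S.Nonempty ∧
      (∀ p ∈ S, ∀ q ∈ S, p ≠ q → Real.sqrt 1250 ≤ dist p q) ∧
      ∀ y ∈ S,
        ((Nat.card ↥{w : EuclideanSpace ℝ (Fin 3) | w ∈ S ∧ w ≠ y ∧
              dist w y < 13 / 10 * sInf ((fun w => dist w y) '' (S \ {y}))} = 12 ∧
            ∀ w ∈ {w : EuclideanSpace ℝ (Fin 3) | w ∈ S ∧ w ≠ y ∧
              dist w y < 13 / 10 * sInf ((fun w => dist w y) '' (S \ {y}))},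
              dist w y ≤ 21 / 20 * sInf ((fun w => dist w y) '' (S \ {y}))) ∧
          ∀ z ∈ S, dist z y < 13 / 5 * sInf ((fun w => dist w y) '' (S \ {y})) →
            (Nat.card ↥{w : EuclideanSpace ℝ (Fin 3) | w ∈ S ∧ w ≠ z ∧
                dist w z < 13 / 10 * sInf ((fun w => dist w z) '' (S \ {z}))} = 12 ∧
              ∀ w ∈ {w : EuclideanSpace ℝ (Fin 3) | w ∈ S ∧ w ≠ z ∧
                dist w z < 13 / 10 * sInf ((fun w => dist w z) '' (S \ {z}))},
                dist w z ≤ 21 / 20 * sInf ((fun w => dist w z) '' (S \ {z})))) ∧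
        ¬ SiteGood S y := by
  have hP : ∀ w : Fin 3 → ℤ, (fun w : Fin 3 → ℤ => intVec ![25 * w 0, 25 * w 1, 27 * w 2]) w =
      intVec ![25 * w 0, 25 * w 1, 27 * w 2] := fun w => rfl
  have hS : {p : EuclideanSpace ℝ (Fin 3) | ∃ w : Fin 3 → ℤ, (w 0 + w 1 + w 2) % 2 = 0 ∧
      (fun w : Fin 3 → ℤ => intVec ![25 * w 0, 25 * w 1, 27 * w 2]) w = p} =
      {p | ∃ w : Fin 3 → ℤ, (w 0 + w 1 + w 2) % 2 = 0 ∧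
        (fun w : Fin 3 → ℤ => intVec ![25 * w 0, 25 * w 1, 27 * w 2]) w = p} := rfl
  refine ⟨_, ⟨_, bct_mem _ hS 0 (by simp)⟩, ?_, ?_⟩
  · rintro p ⟨v, hv, rfl⟩ q ⟨w, hw, rfl⟩ hne
    rw [bct_dist hP v w (v - w) rfl]
    have hne' : v - w ≠ 0 := by
      intro h
      rw [sub_eq_zero] at h
      exact hne (by rw [h])
    have hpar : ((v - w) 0 + (v - w) 1 + (v - w) 2) % 2 = 0 := by
      simp only [Pi.sub_apply]
      omega
    have := bctQ_ge (v - w) hpar hne'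
    have h' : (1250 : ℝ) ≤
        ((625 * (v - w) 0 ^ 2 + 625 * (v - w) 1 ^ 2 + 729 * (v - w) 2 ^ 2 : ℤ) : ℝ) := by
      exact_mod_cast this
    exact Real.sqrt_le_sqrt h'
  · rintro y ⟨u, hu, rfl⟩
    refine ⟨⟨bct_radialTight hP hS u hu, ?_⟩, bct_not_siteGood hP hS u hu⟩
    rintro z ⟨v, hv, rfl⟩ -
    exact bct_radialTight hP hS v hv

/-- **Corollary (the falsifier named on the line card).** The pointwise implication
"radially tight two shells deep ⇒ `SiteGood`" is false at the route's constants
(`13/10` cutoff, `21/20` slack, `1/20` tolerance); consequently `stub_orientationalOrder` is a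
statement about the ENERGY of ground states, not about geometry alone. [folklore] -/
theorem not_forall_twoShellTight_imp_siteGood : ¬ ∀ (S : Set (EuclideanSpace ℝ (Fin 3))) (y : EuclideanSpace ℝ (Fin 3)), y ∈ S → ((Nat.card ↥{w : EuclideanSpace ℝ (Fin 3) | w ∈ S ∧ w ≠ y ∧ dist w y < 13 / 10 * sInf ((fun w => dist w y) '' (S \ {y}))} = 12 ∧ ∀ w ∈ {w : EuclideanSpace ℝ (Fin 3) | w ∈ S ∧ w ≠ y ∧ dist w y < 13 / 10 * sInf ((fun w => dist w y) '' (S \ {y}))}, dist w y ≤ 21 / 20 * sInf ((fun w => dist w y) '' (S \ {y}))) ∧ ∀ z ∈ S, dist z y < 13 / 5 * sInf ((fun w => dist w y) '' (S \ {y})) → (Nat.card ↥{w : EuclideanSpace ℝ (Fin 3) | w ∈ S ∧ w ≠ z ∧ dist w z < 13 / 10 * sInf ((fun w => dist w z) '' (S \ {z}))} = 12 ∧ ∀ w ∈ {w : EuclideanSpace ℝ (Fin 3) | w ∈ S ∧ w ≠ z ∧ dist w z < 13 / 10 * sInf ((fun w => dist w z) '' (S \ {z}))}, dist w z ≤ 21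 / 20 * sInf ((fun w => dist w z) '' (S \ {z})))) → Summit.AtomisticToContinuum.Crystallization.Theorems.SiteGood S y := by
  intro h
  obtain ⟨S, ⟨y, hy⟩, -, hS⟩ := exists_allSites_twoShellTight_not_siteGood
  exact (hS y hy).2 (h S y hy (hS y hy).1)

end Summit.AtomisticToContinuum.Crystallization.Theorems.ZeroDefectDensityBirth

end
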